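import Mathlib
import Summits.MatrixMultiplication.MatrixMultiplication.Theses.FidelityWitnesses
import Literature.Computability.AlgebraicComplexity.BorderRankLimit
import Literature.Computability.AlgebraicComplexity.BorderRankMatMulSmallProofs

/-!
# `FidelityWitnesses.FidelityGapThreeSeventeen` (stmt-MatrixMultiplication-4958) — Negative lane:
# BORDER tightness of the gap constant, `ε ≤ 2/9` (`M(3,17) ≥ 21`), by a kernel-checked
# 17-triad approximate scheme for 21 of the 27 unit products

Support lemma of the standing disprover (`Cruxes/FidelityGapThreeSeventeen/Disproof.lean` §3c),
sharpening `Negative/Tightness.lean` (`ε ≤ 7/27`, an HONEST rank-17 tensor with 20 ones) by a BORDER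
argument: the 0/1 tensor `P21` = `⟨3,3,3⟩` restricted to the 21 ones `{μ ≠ 2} ∪ {(i,2,i)}` (the block
`⟨3,2,3⟩` — first two columns of `A` times first two rows of `B` — plus the diagonal of the
complementary rank-one update `A_{·2} B_{2·}`) has border rank `≤ 17`: Smirnov's approximate algorithm
`⟨3,2,3; 14⟩` (Zh. Vychisl. Mat. Mat. Fiz. 53 (2013), Table 4; kernel-checked in the tree as
`Smirnov2013.isApproxDecomposition_table4`, whose integer-polynomial data `Smirnov2013.uTab/vTab/wTab`
are re-tabulated here padded into the `3 × 3` format) plus the three monomial triads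
`x³ e_{ii} ⊗ e_{i2} ⊗ e_{2i}` is an order-`3` approximate decomposition of `P21` with `17` triads
(`FidelityGapThreeP21.isApproxDecomposition`, checked by `decide +kernel` exactly like
`BorderRankMatMulThreeSmirnov.check333_eq_true`; no `native_decide`).  Hence
`P21 ∈ closure {R ≤ 17}` (`BorderRankLimit`), the gap inequality — a closed condition — holds at
`P21`, and reads `21² ≤ (1 − ε)·27·21`, i.e. **every admissible gap constant has `ε ≤ 2/9`**
(`fidelityGapThreeSeventeen_eps_le_two_ninths`); the fixed-`ε` strengthening with any `ε > 2/9` is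
false (`fidelityGapThreeSeventeen_false_of_eps_gt_two_ninths`).  This is the best bound obtainable
from PRINTED schemes (`⟨3,2,3⟩:14` is optimal, CHL 2023 Thm 1.5(1); the other maximal blocks
`⟨2,2,3⟩:10`, `⟨3,1,3⟩:9` are worse per unit); anything beyond needs a new approximate algorithm.
The file is also the TEMPLATE of a kill: replace the data by a 17-triad scheme for all 27 ones and
`fidelityGapThreeSeventeen_false_of_algBorderRank_le` closes the crux negatively.
No Theses statement is asserted positively.
-/

namespace Summit.MatrixMultiplication.MatrixMultiplication.Theorems

open scoped BigOperators Polynomial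
open Polynomial
open Literature.Computability.AlgebraicComplexity

namespace FidelityGapThreeP21

/-- The 21-one sub-tensor `P21` of `⟨3,3,3⟩` (tree coordinates `a = (i,l)`, `b = (i,j)`, `c = (j,l)`):
the ones with `j ≠ 2` (the block `⟨3,2,3⟩`) or `j = 2 ∧ i = l`. [folklore] -/
def P21 (K : Type) [CommSemiring K] :
    Fin 3 × Fin 3 → Fin 3 × Fin 3 → Fin 3 × Fin 3 → K :=
  fun a b c => if (a.1 = b.1 ∧ b.2 = c.1 ∧ a.2 = c.2) ∧ (b.2 ≠ 2 ∨ b.1 = a.2) then 1 else 0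

/-- entries are `0/1` inside the support of `⟨3,3,3⟩` [folklore] -/
theorem P21_mul_matMul (a b c : Fin 3 × Fin 3) :
    P21 ℂ a b c * matMulTensor ℂ 3 3 3 a b c = P21 ℂ a b c := by
  simp only [P21, matMulTensor]
  split_ifs <;> simp_all

/-- `‖P21_{abc}‖² = P21_{abc}` read in `ℝ` [folklore] -/
theorem norm_sq_P21 (a b c : Fin 3 × Fin 3) : ‖P21 ℂ a b c‖ ^ 2 = P21 ℝ a b c := by
  simp only [P21]
  split_ifs <;> simp

/-- entries are casts of the `ℕ`-valued copy [folklore] -/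
theorem P21_eq_natCast (K : Type) [CommSemiring K] (a b c : Fin 3 × Fin 3) :
    P21 K a b c = ((P21 ℕ a b c : ℕ) : K) := by
  simp only [P21]
  split_ifs <;> simp

/-- the total is the `ℕ`-total [folklore] -/
theorem sum_P21 (K : Type) [CommSemiring K] :
    (∑ a, ∑ b, ∑ c, P21 K a b c) = ((∑ a, ∑ b, ∑ c, P21 ℕ a b c : ℕ) : K) := by
  simp_rw [P21_eq_natCast K]
  push_cast
  rfl

/-- `P21` has 21 ones [folklore] -/
theorem sum_P21_nat : (∑ a, ∑ b, ∑ c, P21 ℕ a b c) = 21 := by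
  decide

/-- `Σ P21·⟨3,3,3⟩ = 21` [folklore] -/
theorem overlap_P21 : (∑ a, ∑ b, ∑ c, P21 ℂ a b c * matMulTensor ℂ 3 3 3 a b c) = (21 : ℂ) := by
  simp_rw [P21_mul_matMul]
  rw [sum_P21 ℂ, sum_P21_nat]
  norm_num

/-- `‖P21‖² = 21` [folklore] -/
theorem normSq_P21 : (∑ a, ∑ b, ∑ c, ‖P21 ℂ a b c‖ ^ 2) = (21 : ℝ) := by
  simp_rw [norm_sq_P21]
  rw [sum_P21 ℝ, sum_P21_nat]
  norm_num

open Smirnov2013 (toPoly coeffL pmul psum coeff_toPoly toPoly_pmul toPoly_psum)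

/-! ## The 17-triad order-3 scheme for `P21` (Smirnov's Table 4 padded, plus 3 monomial triads) -/

/-- `U'ₜ` (`t < 17`): slot of `C` (index `(i,l)`): Smirnov's `x·γᵗ` for `t < 14`, then `x³ e_{ii}` (`i = 0,1,2`). [cite: Smirnov2013, Table 4] -/
def u21Mats : List (Fin 3 → Fin 3 → List ℤ) :=
  [![![[], [0, -1], [0, 1]], ![[0, -1], [0, 1], [-1]], ![[0, 0, 1], [-1], [1]]],
    ![![[0, 0, 1], [], [0, 0, 0, -1]], ![[], [], [1]], ![[1], [0, -1], [-1]]],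
    ![![[0, 0, 0, -1], [], [0, 0, 0, 1]], ![[], [], []], ![[], [], [1]]],
    ![![[], [], []], ![[0, 1], [], [1]], ![[0, 0, -1], [0, -1], []]],
    ![![[], [], [0, 0, 0, 1]], ![[], [], []], ![[], [], [1]]],
    ![![[], [], []], ![[], [], [-1]], ![[], [0, 1], []]],
    ![![[0, 0, 1], [], []], ![[], [], []], ![[1], [], []]],
    ![![[], [], []], ![[0, 1], [0, -1], [1]], ![[0, 0, -1], [], []]],
    ![![[], [], []], ![[], [], [-1]], ![[], [], []]],
    ![![[], [0, 0, 0, 1], [0, 1]], ![[], [], []], ![[], [], [1]]],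
    ![![[], [], [0, 1]], ![[], [], []], ![[], [], [1]]],
    ![![[0, 0, 0, 1, 1], [], []], ![[0, 1], [0, -1], [1]], ![[], [], []]],
    ![![[], [0, 1], []], ![[], [], []], ![[], [1], []]],
    ![![[], [], []], ![[], [0, -1], [1]], ![[], [], []]],
    ![![[0, 0, 0, 1], [], []], ![[], [], []], ![[], [], []]],
    ![![[], [], []], ![[], [0, 0, 0, 1], []], ![[], [], []]],
    ![![[], [], []], ![[], [], []], ![[], [], [0, 0, 0, 1]]]]

/-- `V'ₜ`: slot of `A` (index `(i,j)`): Smirnov's `x·αᵗ` padded by a zero third column for `t < 14`, then `e_{i2}`. [cite: Smirnov2013, Table 4] -/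
def v21Mats : List (Fin 3 → Fin 3 → List ℤ) :=
  [![![[], [1], []], ![[0, 0, 1], [], []], ![[], [], []]],
    ![![[], [1], []], ![[], [], []], ![[0, 0, 0, 1], [0, -1], []]],
    ![![[-1], [], []], ![[], [], []], ![[0, 1, 0, 1], [], []]],
    ![![[], [], []], ![[0, 1], [], []], ![[], [], []]],
    ![![[-1], [-1], []], ![[], [], []], ![[0, 1], [0, 1], []]],
    ![![[], [-1], []], ![[0, 0, -1], [], []], ![[0, 0, 0, -1], [0, 1], []]],
    ![![[], [-1], []], ![[0, 0, 0, 0, 1], [], []], ![[], [0, 1], []]],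
    ![![[], [-1], []], ![[], [], []], ![[], [], []]],
    ![![[], [1], []], ![[0, 0, 1], [0, -1], []], ![[0, 0, 0, 1], [0, -1], []]],
    ![![[1], [], []], ![[], [], []], ![[], [], []]],
    ![![[1], [1], []], ![[0, 0, 1], [], []], ![[], [], []]],
    ![![[], [1], []], ![[], [0, 0, 1], []], ![[], [], []]],
    ![![[], [1], []], ![[0, 0, 1, 1], [], []], ![[0, 0, 0, 1], [], []]],
    ![![[], [], []], ![[], [0, 1], []], ![[], [], []]],
    ![![[], [], [1]], ![[], [], []], ![[], [], []]],
    ![![[], [], []], ![[], [], [1]], ![[], [], []]],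
    ![![[], [], []], ![[], [], []], ![[], [], [1]]]]

/-- `W'ₜ`: slot of `B` (index `(j,l)`): Smirnov's `x·βᵗ` padded by a zero third row for `t < 14`, then `e_{2i}`. [cite: Smirnov2013, Table 4] -/
def w21Mats : List (Fin 3 → Fin 3 → List ℤ) :=
  [![![[], [1], []], ![[], [], []], ![[], [], []]],
    ![![[1], [], []], ![[], [], []], ![[], [], []]],
    ![![[1], [], [0, 0, 1]], ![[], [], [0, 0, -1]], ![[], [], []]],
    ![![[0, 1], [0, 1], [0, 0, 1]], ![[], [], []], ![[], [], []]],
    ![![[-1], [], []], ![[], [], [0, 0, 1]], ![[], [], []]],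
    ![![[-1], [], []], ![[], [0, 1], []], ![[], [], []]],
    ![![[1], [], []], ![[0, 0, 1], [], []], ![[], [], []]],
    ![![[], [-1], []], ![[1], [], []], ![[], [], []]],
    ![![[], [], []], ![[], [0, 1], []], ![[], [], []]],
    ![![[], [1], [0, 0, 1]], ![[], [], [0, 0, -1]], ![[], [], []]],
    ![![[], [-1], []], ![[], [], [0, 0, 1]], ![[], [], []]],
    ![![[], [], []], ![[1], [], []], ![[], [], []]],
    ![![[], [1], []], ![[], [0, 0, 1], []], ![[], [], []]],
    ![![[], [], []], ![[0, -1], [0, -1], [0, 0, 1]], ![[], [], []]],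
    ![![[], [], []], ![[], [], []], ![[1], [], []]],
    ![![[], [], []], ![[], [], []], ![[], [1], []]],
    ![![[], [], []], ![[], [], []], ![[], [], [1]]]]

/-- `U'ₜ` indexed by `t : Fin 17`. [cite: Smirnov2013, Table 4] -/
def uTab (t : Fin 17) : Fin 3 → Fin 3 → List ℤ := u21Mats.getD t fun _ _ => []

/-- `V'ₜ` indexed by `t : Fin 17`. [cite: Smirnov2013, Table 4] -/
def vTab (t : Fin 17) : Fin 3 → Fin 3 → List ℤ := v21Mats.getD t fun _ _ => []

/-- `W'ₜ` indexed by `t : Fin 17`. [cite: Smirnov2013, Table 4] -/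
def wTab (t : Fin 17) : Fin 3 → Fin 3 → List ℤ := w21Mats.getD t fun _ _ => []

/-- entry `((i,l),(i',j),(j',l'))` of `∑ₜ U'ₜ ⊗ V'ₜ ⊗ W'ₜ` as an integer polynomial
[cite: Smirnov2013, Table 4] -/
def entryPoly (i l i' j j' l' : Fin 3) : List ℤ :=
  psum (List.ofFn fun t : Fin 17 => pmul (pmul (uTab t i l) (vTab t i' j)) (wTab t j' l'))

/-- expected coefficients: `x³ · P21`, zero below degree `3` [folklore] -/
def rhsZ (i l i' j j' l' : Fin 3) (d : ℕ) : ℤ :=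
  if d = 3 then (if (i = i' ∧ j = j' ∧ l = l') ∧ (j ≠ 2 ∨ i' = l) then 1 else 0) else 0

/-- the check of one entry in degrees `0, …, 3` [folklore] -/
def checkEntry (i l i' j j' l' : Fin 3) : Bool :=
  let p := entryPoly i l i' j j' l'
  (List.range 4).all fun d => coeffL p d == rhsZ i l i' j j' l' d

/-- the whole finite check: all `9 · 9 · 9` entries [folklore] -/
def check21 : Bool :=
  (List.finRange 3).all fun i => (List.finRange 3).all fun l => (List.finRange 3).all fun i' =>
    (List.finRange 3).all fun j => (List.finRange 3).all fun j' => (List.finRange 3).all fun l' =>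
      checkEntry i l i' j j' l'

/-- The kernel runs the check (no `native_decide`). [folklore] -/
theorem check21_eq_true : check21 = true := by
  decide +kernel

/-- Unpacking `check21`: entry by entry, degree by degree. [folklore] -/
theorem coeffL_entryPoly (i l i' j j' l' : Fin 3) {d : ℕ} (hd : d ≤ 3) :
    coeffL (entryPoly i l i' j j' l') d = rhsZ i l i' j j' l' d := by
  have h := check21_eq_true
  simp only [check21, List.all_eq_true] at h
  have h' : checkEntry i l i' j j' l' = true :=
    h i (List.mem_finRange i) l (List.mem_finRange l) i' (List.mem_finRange i')
      j (List.mem_finRange j) j' (List.mem_finRange j') l' (List.mem_finRange l')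
  simp only [checkEntry, List.all_eq_true, beq_iff_eq] at h'
  exact h' d (List.mem_range.2 (by omega))

section Transport
variable (K : Type) [CommRing K]

/-- first vectors `U'ₜ ∈ K[x]^{3×3}` (slot of `C`). [cite: Smirnov2013, Table 4] -/
noncomputable def uC (t : Fin 17) (a : Fin 3 × Fin 3) : K[X] := toPoly (uTab t a.1 a.2)

/-- second vectors `V'ₜ ∈ K[x]^{3×3}` (slot of `A`). [cite: Smirnov2013, Table 4] -/
noncomputable def vC (t : Fin 17) (b : Fin 3 × Fin 3) : K[X] := toPoly (vTab t b.1 b.2)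

/-- third vectors `W'ₜ ∈ K[x]^{3×3}` (slot of `B`). [cite: Smirnov2013, Table 4] -/
noncomputable def wC (t : Fin 17) (c : Fin 3 × Fin 3) : K[X] := toPoly (wTab t c.1 c.2)

/-- **An order-`3` approximate decomposition of `P21` with `17` triads over every commutative ring**:
Smirnov's `⟨3,2,3; 14⟩` padded into the `3 × 3` format plus `x³ e_{ii} ⊗ e_{i2} ⊗ e_{2i}`,
`i = 0, 1, 2`. [cite: Smirnov2013, Table 4] -/
theorem isApproxDecomposition :
    IsApproxDecomposition 3 (P21 K) (uC K) (vC K) (wC K) := by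
  intro a b c d hd
  have hsum : (∑ t, uC K t a * vC K t b * wC K t c) =
      toPoly (entryPoly a.1 a.2 b.1 b.2 c.1 c.2) := by
    rw [entryPoly, toPoly_psum, List.map_ofFn, List.sum_ofFn]
    refine Finset.sum_congr rfl fun t _ => ?_
    simp only [Function.comp_apply, toPoly_pmul, uC, vC, wC]
  rw [hsum, coeff_toPoly, coeffL_entryPoly _ _ _ _ _ _ hd, rhsZ]
  simp only [P21]
  split_ifs <;> simp_all

end Transport

/-- **`R₃(P21) ≤ 17`** (order-3 approximate rank). [cite: Smirnov2013, Table 4] -/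
theorem approxRank_three_P21_le : approxRank 3 (P21 ℂ) ≤ 17 :=
  approxRank_le_of_isApproxDecomposition (isApproxDecomposition ℂ)

/-- **`bR(P21) ≤ 17`**: 21 of the 27 unit products of `3 × 3` matrix multiplication cost at most
17 border multiplications. [cite: Smirnov2013, Table 4] -/
theorem algBorderRank_P21_le : algBorderRank (P21 ℂ) ≤ 17 :=
  (algBorderRank_le_approxRank 3 _).trans approxRank_three_P21_le

/-- `P21` is a limit of rank-`≤ 17` tensors. [folklore] -/
theorem P21_mem_closure :
    P21 ℂ ∈ closure {S : (Fin 3 × Fin 3) → (Fin 3 × Fin 3) → (Fin 3 × Fin 3) → ℂ |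
      tensorRank S ≤ 17} :=
  mem_closure_setOf_tensorRank_le_of_algBorderRank_le algBorderRank_P21_le

end FidelityGapThreeP21

/-- **A gap inequality at `(3, r)` is a closed condition**: it passes from the rank-`≤ r` tensors to
their limits (both sides are continuous in `S`). [folklore] -/
theorem fidelityGapThree_gap_of_mem_closure {r : ℕ} {ε : ℝ}
    (h : ∀ S : (Fin 3 × Fin 3) → (Fin 3 × Fin 3) → (Fin 3 × Fin 3) → ℂ, tensorRank S ≤ r →
      ‖∑ a, ∑ b, ∑ c, S a b c * matMulTensor ℂ 3 3 3 a b c‖ ^ 2 ≤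
        (1 - ε) * 27 * ∑ a, ∑ b, ∑ c, ‖S a b c‖ ^ 2)
    {S : (Fin 3 × Fin 3) → (Fin 3 × Fin 3) → (Fin 3 × Fin 3) → ℂ}
    (hS : S ∈ closure {S : (Fin 3 × Fin 3) → (Fin 3 × Fin 3) → (Fin 3 × Fin 3) → ℂ |
      tensorRank S ≤ r}) :
    ‖∑ a, ∑ b, ∑ c, S a b c * matMulTensor ℂ 3 3 3 a b c‖ ^ 2 ≤
      (1 - ε) * 27 * ∑ a, ∑ b, ∑ c, ‖S a b c‖ ^ 2 := by
  have hclosed : IsClosed {S : (Fin 3 × Fin 3) → (Fin 3 × Fin 3) → (Fin 3 × Fin 3) → ℂ |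
      ‖∑ a, ∑ b, ∑ c, S a b c * matMulTensor ℂ 3 3 3 a b c‖ ^ 2 ≤
        (1 - ε) * 27 * ∑ a, ∑ b, ∑ c, ‖S a b c‖ ^ 2} :=
    isClosed_le (by fun_prop) (by fun_prop)
  exact closure_minimal (fun S hS => h S hS) hclosed hS

/-- **Border tightness of the crux's gap constant**: if `ε` is a fidelity-gap constant at `(3, 17)`
(the body of `FidelityGapThreeSeventeen` with this `ε`), then `ε ≤ 2/9` (`= 6/27`) — the gap
inequality holds at the border-rank-`≤ 17` limit tensor `P21` of fidelity `21/27`. [folklore] -/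
theorem fidelityGapThreeSeventeen_eps_le_two_ninths {ε : ℝ}
    (h : ∀ S : (Fin 3 × Fin 3) → (Fin 3 × Fin 3) → (Fin 3 × Fin 3) → ℂ, tensorRank S ≤ 17 →
      ‖∑ a, ∑ b, ∑ c, S a b c * matMulTensor ℂ 3 3 3 a b c‖ ^ 2 ≤
        (1 - ε) * 27 * ∑ a, ∑ b, ∑ c, ‖S a b c‖ ^ 2) :
    ε ≤ 2 / 9 := by
  have key := fidelityGapThree_gap_of_mem_closure h FidelityGapThreeP21.P21_mem_closure
  rw [FidelityGapThreeP21.overlap_P21, FidelityGapThreeP21.normSq_P21] at key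
  have : ‖(21 : ℂ)‖ = 21 := by
    rw [show (21 : ℂ) = ((21 : ℝ) : ℂ) by norm_num, Complex.norm_real]
    norm_num
  rw [this] at key
  nlinarith

/-- Equivalently: the fixed-`ε` strengthening of the crux with any `ε > 2/9` is FALSE. [folklore] -/
theorem fidelityGapThreeSeventeen_false_of_eps_gt_two_ninths {ε : ℝ} (hε : 2 / 9 < ε) :
    ¬ ∀ S : (Fin 3 × Fin 3) → (Fin 3 × Fin 3) → (Fin 3 × Fin 3) → ℂ, tensorRank S ≤ 17 →
      ‖∑ a, ∑ b, ∑ c, S a b c * matMulTensor ℂ 3 3 3 a b c‖ ^ 2 ≤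
        (1 - ε) * 27 * ∑ a, ∑ b, ∑ c, ‖S a b c‖ ^ 2 :=
  fun h => absurd (fidelityGapThreeSeventeen_eps_le_two_ninths h) (not_le.mpr hε)

end Summit.MatrixMultiplication.MatrixMultiplication.Theorems
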